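import Summits.QuantumFields.BalabanUV.Beta.SymMixedJetWard
import Summits.QuantumFields.BalabanUV.Beta.MixedJetWardSingle

/-!
# `BalabanUV.Beta.SymMixedJetWardSingle` — THE JET WARD IDENTITY OF THE (0.4)-SYMMETRISED ROOTED MIXED JET AT SINGLE LETTERS, EVERY TERM A SYM COUNT
# (β sub-cell, row D1, TABLES-SYM-LEAN S2c∕S2d, INTERFACE-LEVEL twin of an2-g21's `MixedJetWardSingle`; an1 gen 43; the mixed path to (T2-M₂))

HONEST FRAMING (cell charter, verbatim): «discharging BetaPertH makes Bałaban's UV stability UNCONDITIONAL — a real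
constructive-QFT result; it is NOT the continuum limit and NOT the Clay problem.»  HONEST DEPENDENCY (verbatim): «continuum YM on
T⁴ ⇐ BetaPertH ∧ nine spine estimates (0/9 proved); BetaPertH ⇐ (D1) ∧ (D4) ∧ CAP+tail; G-an2-4 gates asym, D1 and NE2/3/4.»
ABSOLUTE RULE (R-g25-7 ∕ R-D1-g30-1 (A)): the (0.4)-symmetrised averaging is the exp of the MEAN OF LOGS over the pair family
`{loop^{σ,σ′}}` with weight `((d!)²·L^d)⁻¹`; every object below is the comb module's algebra read on an1's `symPhiGAt` (S2b part 1)
instead of `PhiGAt` — STATEMENT FOR STATEMENT under the dictionary `PhiXAt ↦ symPhiXAt`, `XjetAt ↦ symXjetAt`, `MσXAt ↦ symMσXAt`,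
`L^{-d}·linAvgAt ↦ (d!·L^d)⁻¹·symLinU`, `L^{-d}·hessUAt ↦ ((d!)²L^d)⁻¹·symHessUAt`, `L^{-2d}·vhUAt ↦ ((d!)²L^{2d})⁻¹·symVhUAt`
(an3-g63 [AN3-G63-S2C] (C-ii): constants PER BCH ORDER; CONVENTION `(d!)²` un-normalised inside order-2 sym functionals).
FAMILY-INDEPENDENT chart ∕ letter ∕ `Tau`-algebra lemmas of the comb module are imported BY NAME, never re-proved.
DERIVED cell leaf: [folklore] ring algebra; the `sym*` families are [our object]s.  No statement of Bałaban's papers is typed here, no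
`[cite:]` tag, no `Prop` is minted, no binder of the β-function wall (`hW`/`hR`/`D1Tel`/`D1Rep`, (D1), `BetaPertH`) is instantiated or
discharged; nothing about the VALUES of `symMixFFAt`∕`symVh₂SAt` and no (T2-B)∕(T2-M₂) letter is discharged in this file.
NOT D1, NOT BetaPertH, NOT continuum, NOT Clay.  NOT summit progress.
Provenance: β sub-cell, TABLES-SYM-LEAN S2c option (C) (S2C-SCOPE-v1 94facb80ac685517), unit b2b-balaban-beta-an1-g43 (W-supplier AN1,
FREEZE (0): scratch for a courier; an1 files nothing), 2026-08-21; no existing file touched.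

## What this module proves (sym twin of `MixedJetWardSingle` §2; its §1 `βg1_single βg2_single βg3_single` is letter algebra, the comb module's BY NAME)
* §2 **`symMjetAt_gauge_single`** (`W = single F a`, `V = single F′ b`, gauge function `λ`, generator `D`, root `r = L·y + ρ`):
  `symM^ρ_b(single F a, single F′ b; (dλ)•D)`
  `= (2(d!)²L^d)⁻¹ • ((symHessCountAt F′ F + [F′=F]·d!·symLinCountAt F′) • [b, λ(x_F)•[D,a]])`
  `+ (2(d!)²L^d)⁻¹ • ((symHessCountAt F F′ + [F=F′]·d!·symLinCountAt F) • [a, λ(x_{F′})•[D,b]])`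
  `+ (d!·L^d)⁻¹ • (symLinCountAt F • [F=F′]·λ(x_F)•(h₀D + Dh₀ − aDb − bDa))`
  `− ((λ(r)•D)·H − H·(λ(r)•D))`, `H = (2(d!)²L^d)⁻¹ • (symHessCountAt F F′ • [a,b])` — an1's `SymMixedJetWard.symMjetAt_gauge_counts` with its contact
  functionals evaluated by the LANDED sym counts `symHessUAt_single` ∕ `symLinU_single` (`SymAveragingHessianCountsWords`) and node 7a's `bw_single`.
The statement carries the extra hypothesis `(hd : ((d ! : ℕ) : 𝕜) ≠ 0)` (before `hL`).
-/

namespace Summit.QuantumFields.BalabanUV.Beta.SymMixedJetWardSingle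

open Literature.MathematicalPhysics.QuantumFieldTheory.Balaban1983to89
open Literature.MathematicalPhysics.QuantumFieldTheory.Balaban1983to89.Beta
open scoped Nat
open AffineAveraging (Form1 unitVec)
open AveragingContoursRooted (ctr)
open AveragingHessianKernels (Bond single single_apply bw bw_single)
open Summit.QuantumFields.BalabanUV.Beta.SymAveragingHessianCounts (symLinU symHessUAt symLinCountAt symHessCountAt symLinU_single symHessUAt_single)
open Summit.QuantumFields.BalabanUV.Beta.SymAveragingMixedJetTables (symMjetAt)
open Summit.QuantumFields.BalabanUV.Beta.MixedJetWard (βg1 βg2 βg3)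
open Summit.QuantumFields.BalabanUV.Beta.SymMixedJetWard (symMjetAt_gauge_counts)
open Summit.QuantumFields.BalabanUV.Beta.MixedJetWardSingle (βg1_single βg2_single βg3_single)

variable {𝕜 : Type*} [Field 𝕜] {d : ℕ} {𝔸 : Type*} [Ring 𝔸] [Algebra 𝕜 𝔸]
variable (lam : (Fin d → ℤ) → 𝕜) (D : 𝔸)

/-! ## §1 The rotation-defect components at single letters: letter algebra, the comb module's `βg1_single βg2_single βg3_single` BY NAME -/

/-! ## §2 The jet Ward identity at single letters -/

open Classical in
/-- [folklore] **THE JET WARD IDENTITY OF THE (0.4)-SYMMETRISED ROOTED MIXED JET AT SINGLE LETTERS, EVERY TERM A SYM COUNT** (`(L:𝕜) ≠ 0`, char ≠ 2):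
an1's `SymMixedJetWard.symMjetAt_gauge_counts` (sym twin of G2) with its contact functionals evaluated by the landed sym counts `symHessUAt_single`∕`symLinU_single`
and node 7a's `bw_single`; constants `(2L^d)⁻¹ ↦ (2(d!)²L^d)⁻¹`, `L^{-d} ↦ (d!·L^d)⁻¹`, `[F′=F] linCountAt ↦ [F′=F] d!·symLinCountAt`. -/
theorem symMjetAt_gauge_single {L : ℕ} (hd : ((d ! : ℕ) : 𝕜) ≠ 0) (hL : (L : 𝕜) ≠ 0) (h2 : (2 : 𝕜) ≠ 0) (ρ : Fin d → ℤ) (F F' : Bond d) (a b : 𝔸) (μ : Fin d)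
    (y : Fin d → ℤ) :
    symMjetAt 𝕜 ρ (single F a) (single F' b) (fun κ x => (lam (x + unitVec κ) - lam x) • D) L μ y
      = ((2 : 𝕜) * ((d ! : 𝕜) ^ 2 * (L : 𝕜) ^ d))⁻¹ •
            ((symHessCountAt ρ L μ y F' F • AveragingHessianKernels.comm b (lam F.2 • AveragingHessianKernels.comm D a))
              + (if F' = F then ((d ! : ℤ) * symLinCountAt ρ L μ y F') • AveragingHessianKernels.comm b (lam F.2 • AveragingHessianKernels.comm D a) else 0))
        + ((2 : 𝕜) * ((d ! : 𝕜) ^ 2 * (L : 𝕜) ^ d))⁻¹ •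
            ((symHessCountAt ρ L μ y F F' • AveragingHessianKernels.comm a (lam F'.2 • AveragingHessianKernels.comm D b))
              + (if F = F' then ((d ! : ℤ) * symLinCountAt ρ L μ y F) • AveragingHessianKernels.comm a (lam F'.2 • AveragingHessianKernels.comm D b) else 0))
        + ((d ! : 𝕜) * (L : 𝕜) ^ d)⁻¹ • (symLinCountAt ρ L μ y F •
            (if F = F' then lam F.2 • (((2 : 𝕜)⁻¹ • (a * b + b * a)) * D + D * ((2 : 𝕜)⁻¹ • (a * b + b * a)) - a * D * b - b * D * a)
              else 0))
        - ((lam ((L : ℤ) • y + ρ) • D) * (((2 : 𝕜) * ((d ! : 𝕜) ^ 2 * (L : 𝕜) ^ d))⁻¹ • (symHessCountAt ρ L μ y F F' • AveragingHessianKernels.comm a b))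
            - (((2 : 𝕜) * ((d ! : 𝕜) ^ 2 * (L : 𝕜) ^ d))⁻¹ • (symHessCountAt ρ L μ y F F' • AveragingHessianKernels.comm a b)) * (lam ((L : ℤ) • y + ρ) • D)) := by
  rw [symMjetAt_gauge_counts lam D hd hL h2, βg1_single, βg2_single, βg3_single, symHessUAt_single, symHessUAt_single, symHessUAt_single, bw_single,
    bw_single, symLinU_single, symLinU_single, symLinU_single]
  congr 1
  congr 1
  congr 1
  · congr 1
    by_cases h : F' = F
    · rw [if_pos h, if_pos h, smul_smul]
    · rw [if_neg h, if_neg h, smul_zero, smul_zero]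
  · congr 1
    by_cases h : F = F'
    · rw [if_pos h, if_pos h, smul_smul]
    · rw [if_neg h, if_neg h, smul_zero, smul_zero]

end Summit.QuantumFields.BalabanUV.Beta.SymMixedJetWardSingle
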